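import Literature.Probability.Percolation.KhSThreeDisorderContour
import Literature.Probability.Percolation.KhSThreeDisorderNormalisation
import HarnessLib

/-!
# The law of the link pattern of a boundary mid-edge, for ANY ODD NUMBER of boundary disorders

Topic `Literature/Probability/Percolation`; three-disorder lineage, generic-`k` layer. Khristoforov–Smirnov §1.2 sets up loop
configurations `W_Ω(u₁, …, u_k)` with `k` disorders at marked points (non-empty for `k` even; `#W = 2^{#Faces(Ω)}`; the interface
part `IP(ξ)` is a union of disjoint paths MATCHING the marked points — the link pattern) and asks for «the law of the link pattern of
the uniformly random loop configuration with disorders at marked points»; §2 (Definition 3) then specialises to THREE boundary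
disorders `u₁, u₂, u₃` plus the mid-edge `z`, where the partner of `z` has three possible values and `H_j(z) = P^loop[z ↔ u_j]`.

This file records the generic-`k` marginal law of the partner of `z`, which the tree's generic XOR-space layer already proves:
for a `k`-marked discrete domain `D : TriMarkedDomain k` with `k` ODD (so that `k + 1` disorders — the `k` corner faces and the
mid-edge `z` — is even), at every side `i` of a face `v` with three `H_G`-sides,

* `classCountK D v i j = N_j(z)` — the number of configurations of `W_Ω(u₁, …, u_k, z)` (both halves of the subdivided edge) in which
  the strand from `z` ends at the corner `u_j` (`j : Fin k`), and `HobsK D v i j = N_j(z) / 2^{#G}`;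
* ★ `sum_classCountK_eq` — `Σ_{j : Fin k} N_j(z) = 2^{#G}`: the `k` link events `[z ↔ u_j]` PARTITION `W` (`existsUnique_inClassX`:
  every configuration has exactly one partner; `card_TXb_add_card_TXb`: `#W = 2^{#G}` over both halves);
* `sum_hobsK_eq_one`, `hobsK_nonneg`, `hobsK_le_one` — the partner law is a probability vector;
* `classCountK_oppFace_oppIdx`, `hobsK_oppFace_oppIdx` — it is a function of the mid-edge (the two faces of the edge agree);
* `classCountK_three`, `hobsK_three` — at `k = 3` these are the tree's `classCount`, `Hobs` of Definition 3 (by `rfl`).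

No percolation-side statement is made here for `k > 3` (the colouring ↔ loop correspondence with `k − 1` boundary colour changes is
typed in the tree for `k = 3` (`TriIface3`), `k = 4` (four marks) and `k = 5` (the five-point files) only).

## References
* M. Khristoforov, S. Smirnov, *Percolation and O(1) loop model*, arXiv:2111.15612 (2021), §1.2 (arXiv v1 p. 2: `W_Ω(u₁,…,u_k)`,
  `IP(ξ)`, the link pattern, `#W = 2^{#F(Ω)}`, «the law of the link pattern»), §2 Definition 3 (p. 4: `k = 3`).

## Mathlib / tree
Tree only: `KhSThreeDisorderObservable.lean` (`AllSides`, `TXb`, `InClassX`, `classCount`, `Hobs`), `KhSThreeDisorderNormalisation.lean`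
(generic section `Count`: `card_TXb_add_card_TXb`, `existsUnique_inClassX`, `sum_card_filter_inClassX`), `KhSThreeDisorderContour.lean`
(generic section `EdgeSymmetry`: `card_filter_inClassX_comm`, `TXb_oppFace_oppIdx`; `faceVertex_oppFace_succ(_succ)`, `oppFace_oppFace`).
-/

open Finset

namespace Literature.Probability.Percolation.MarkedLoops

open Literature.Probability.Percolation Literature.Probability.LatticeModels
open Literature.Probability.Percolation.FivePoint (side tau)
open Literature.Probability.Percolation.FivePoint.N5 (side_oppFace_oppIdx)
open TriMarkedDomain

section ManyMarks

variable {nm : ℕ} (D : TriMarkedDomain nm)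

open Classical in
/-- **`N_j(z)` for `k` marks**: the number of loop configurations with disorders at the `k` corner faces and at the mid-edge `z` of the
`i`-th side of `v` in which `z` is linked to the corner `u_j` — both halves of the subdivided edge.
[cite: KhristoforovSmirnov2021, §1.2 (the link pattern; arXiv v1 p. 2) and §2 Definition 3 (p. 4, k = 3)] -/
noncomputable def classCountK (v : HexVertex) (i : Fin 3) (j : Fin nm) : ℕ :=
  #((TXb D v i v).filter fun ξ => InClassX D (faceVertex v (i + 1)) (faceVertex v (i + 2)) v j ξ) +
    #((TXb D v i (oppFace v i)).filter fun ξ => InClassX D (faceVertex v (i + 1)) (faceVertex v (i + 2)) (oppFace v i) j ξ)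

/-- **`H_j(z) = P^loop[z ↔ u_j]` for `k` marks** (uniform measure; denominator `2^{#G}`).
[cite: KhristoforovSmirnov2021, §1.2 (the law of the link pattern; arXiv v1 p. 2) and §2 Definition 3 (p. 4, k = 3)] -/
noncomputable def HobsK (v : HexVertex) (i : Fin 3) (j : Fin nm) : ℝ := (classCountK D v i j : ℝ) / 2 ^ #D.verts

/-- ★ **the link events of `z` partition `W_Ω(u₁, …, u_k, z)`**: for `k` odd, `Σ_{j : Fin k} N_j(z) = 2^{#G}` at every side of a face with
three `H_G`-sides. [cite: KhristoforovSmirnov2021, §1.2 (arXiv v1 p. 2: «there are exactly 2^{#F(Ω)} loop configurations with given disorders»; «IP(ξ) is a union of disjoint paths, matching marked points»)] -/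
theorem sum_classCountK_eq (hodd : Odd nm) {v : HexVertex} (hv : AllSides D v) (i : Fin 3) :
    ∑ j : Fin nm, classCountK D v i j = 2 ^ #D.verts := by
  classical
  unfold classCountK
  rw [Finset.sum_add_distrib, sum_card_filter_inClassX D hv i (by simp), sum_card_filter_inClassX D hv i (by simp),
    card_TXb_add_card_TXb D hodd hv i]

/-- ★ **`Σ_j H_j(z) = 1`** for `k` odd. [cite: KhristoforovSmirnov2021, §1.2 (arXiv v1 p. 2) and §2 Definition 3 (p. 4)] -/
theorem sum_hobsK_eq_one (hodd : Odd nm) {v : HexVertex} (hv : AllSides D v) (i : Fin 3) : ∑ j : Fin nm, HobsK D v i j = 1 := by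
  unfold HobsK
  rw [← Finset.sum_div, ← Nat.cast_sum, sum_classCountK_eq D hodd hv i]
  push_cast
  exact div_self (pow_ne_zero _ two_ne_zero)

/-- `H_j(z) ≥ 0`. [cite: KhristoforovSmirnov2021, §1.2 (arXiv v1 p. 2)] -/
theorem hobsK_nonneg (v : HexVertex) (i : Fin 3) (j : Fin nm) : 0 ≤ HobsK D v i j := by
  unfold HobsK
  positivity

/-- `H_j(z) ≤ 1` for `k` odd at every side of a face with three `H_G`-sides. [cite: KhristoforovSmirnov2021, §1.2 (arXiv v1 p. 2)] -/
theorem hobsK_le_one (hodd : Odd nm) {v : HexVertex} (hv : AllSides D v) (i : Fin 3) (j : Fin nm) : HobsK D v i j ≤ 1 := by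
  rw [← sum_hobsK_eq_one D hodd hv i]
  exact Finset.single_le_sum (fun j' _ => hobsK_nonneg D v i j') (Finset.mem_univ j)

open Classical in
/-- **`N_j(z)` is a function of the mid-edge**: counted from either face of the edge it is the same number.
[cite: KhristoforovSmirnov2021, §1.2 (arXiv v1 p. 2)] -/
theorem classCountK_oppFace_oppIdx (v : HexVertex) (i : Fin 3) (j : Fin nm) :
    classCountK D (oppFace v i) (oppIdx v i) j = classCountK D v i j := by
  unfold classCountK TXb
  rw [faceVertex_oppFace_succ, faceVertex_oppFace_succ_succ, oppFace_oppFace, add_comm,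
    card_filter_inClassX_comm D (faceVertex v (i + 2)) (faceVertex v (i + 1)) v j,
    card_filter_inClassX_comm D (faceVertex v (i + 2)) (faceVertex v (i + 1)) (oppFace v i) j]

/-- `H_j(z)` is a function of the mid-edge. [cite: KhristoforovSmirnov2021, §1.2 (arXiv v1 p. 2)] -/
theorem hobsK_oppFace_oppIdx (v : HexVertex) (i : Fin 3) (j : Fin nm) : HobsK D (oppFace v i) (oppIdx v i) j = HobsK D v i j := by
  unfold HobsK
  rw [classCountK_oppFace_oppIdx]

end ManyMarks

section ThreeMarks

variable (D : TriMarkedDomain 3)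

/-- at `k = 3`, `classCountK` IS Definition 3's `N_j(z)` (`classCount`). [cite: KhristoforovSmirnov2021, §2 Definition 3 (arXiv v1 p. 4)] -/
theorem classCountK_three (v : HexVertex) (i j : Fin 3) : classCountK D v i j = classCount D v i j := rfl

/-- at `k = 3`, `HobsK` IS Definition 3's `H_j(z)` (`Hobs`). [cite: KhristoforovSmirnov2021, §2 Definition 3 (arXiv v1 p. 4)] -/
theorem hobsK_three (v : HexVertex) (i j : Fin 3) : HobsK D v i j = Hobs D v i j := rfl

end ThreeMarks

end Literature.Probability.Percolation.MarkedLoops
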